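import Summits.Ventures.CertifiedManyBodySolver.Downfold.BoxesHg1201EP10KinematicCoverN
import Summits.Ventures.CertifiedManyBodySolver.Observables.RungLeavesCoverageHg1201PatchL
import Summits.Ventures.CertifiedManyBodySolver.Rows.DopedTLCorrBoxWindow
import Summits.Ventures.CertifiedManyBodySolver.Certificates.HubbardSquare_hfCaps_hg1201_P10
import Literature.MathematicalPhysics.QuantumLattice.HubbardEnergyDensityChordBounds
import HarnessLib

/-!
# Ventures/CertifiedManyBodySolver — Theorems/CovHg1201M19P10StripAdapters.lean

HONEST FRAMING: zero-solve CLOSERS (pure bookkeeping) for route `CovHg1201M19P10` (HgBa₂CuO₄₊δ «Hg-1201» @ 10 GPa, D-0154 (1)(C); the ONLY pressure leg typed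
in the tree) — the `P = 10 GPa` TWIN of hubbard-cov-hg1201-box-1 g0's `Theorems/CovHg1201M19b{StubAdapters,BoxRowWAdapters,StripClosers}.lean`. Items
**stmt-Ventures-27104 `PatchLeftEdgeP10`** (registered stubs `stub_leftEdgeP10_lowU : LeftEdgeLowUP10` on `U′ ∈ [3, 5]`, `stub_leftEdgeP10_highU : LeftEdgeHighUP10`
on `[5, 17/2]`) and **stmt-Ventures-27105 `PatchBottomP10`** (`stub_bottomP10_nHigh : BottomNHighP10` on `n ∈ [43/50, 22/25]`; `stub_bottomP10_nLow` is
state-free and discharged in `Theorems/CovHg1201M19P10StubBottomNLow.lean`). Patch `P = t′ ∈ [−49/100, −47/100] × U ∈ [3, 17/2] × n ∈ [21/25, 22/25]`,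
bar `0.4767609 = ⌊0.98 × 0.4864908⌋₇`, density cut `n_k′ = 43/50` (captain RULING 2026-08-28T09:00:42Z; hubbard-cov-hg1201-box-2 g0's `M = 512` kernel row,
`Downfold/BoxesHg1201EP10KinematicCoverN.lean` p621284, `Theorems/CovHg1201M19P10KinematicParts.lean` p621678).

* §0 the `σ`-chord tools on `[−49/100, −47/100]` (the inner-END objective `−X₀(−47/100, ·)` is read KINEMATICALLY at every `n ≤ 22/25`:
  `halfBathtub_m47o100_P10chordLevel_le` + `orbitMean_neg_oddMomentTT_lam_zero_ge_kinematic_of_gs`, value `≥ −0.4763357 ≥ −0.4767609`);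
* §1 segment bundles FROM CORNER-OBJECTIVE READS (`−X₀(−49/100, ·)` only; the chord with the kinematic inner read is a convex combination of sub-bar prices);
* §2 the same FROM ONE cap-only `boxdual/0` tree cell `SquareTTPrimeCorrOrbitLowerBoxRow` and FROM ONE WINDOWED cell `SquareTTPrimeCorrOrbitLowerBoxRowW`
  (floor row = the a-priori kinematic constant `−124827703/50000000`, discharged on every P10 cell — `|t′| ≤ 49/100 ≤ 27/50`; cap row = ANY `cap` discharged by `hcap`);
* §3 kernel Hartree–Fock density-CHORD caps DISCHARGED on the P10 strip cells `n ∈ [43/50, 22/25]` (box-1's rows `hfCap_hg1201P10_m490_n086/_n088_point`,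
  `hfCap_hg1201P10_m490_m470_n086/_n088`, p621332; convexity of `e₀` in `n`, `energyDensityTT'_le_density_chord`) — valid for every `U ≥ 0`;
* the sibling `Theorems/CovHg1201M19P10StripClosers.lean` then gives each registered stub body from ONE windowed strip-cell node, and the items / the rung leaf
  «MOS2-hg1201-M19P10» from two + one cells (or a `U`-ladder of left cells) via the route's `closes`.

ROUTE-INDEPENDENT module (no `Theses` import; the four small reading tools of box-1's M19b adapters are re-derived in §2 in P10-specialised form so that no
M19b route file enters the cone). The statements are the stub bodies VERBATIM (a stub file re-homes the `def` and closes by `exact`). Nothing here is a certificate or a number of record; CONTROL /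
CALIBRATION class words only ever flow through it (wording (xx1); «content» = below `0.98 ×` the kinematic MAJORANT word, no suppression below free claimed;
pressure enters only through the downfolded `(U/t, t′/t)` frame — SCREENING-GRADE; no `dT_c/dP` sentence); a ceiling never speaks to the presence of
superconductivity; not a `T_c` or phase sentence; nothing here is a statement about HgBa₂CuO₄₊δ; no item or stub is closed by this file alone (the cell nodes are the
producers' pinned reads, not yet printed).

Cell `pub/hubbard-obs`, seat `hubbard-cov-hg1201-box-2` g1 (`prover-hubbard-cov-hg1201-box-2-g0-0`; @10 box lane, captain RULING «BOX LANE SPLIT @0 / @10»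
2026-08-28T10:09:32Z, ask (b) of the captain's WORD 10:08:20Z).
References: W.-K. Wang et al. (2024) §III [WangEtAl2024]; D. J. Scalapino, S. R. White, S.-C. Zhang, PRB 47 (1993) 7995, §II [ScalapinoWhiteZhang1993];
T. Koma, H. Tasaki, J. Stat. Phys. 76 (1994) 745, §1 [KomaTasaki1994]; V. Bach, E. H. Lieb, J. P. Solovej, J. Stat. Phys. 76 (1994) 3 [BachLiebSolovej1994];
R. B. Israel (1979) Thm. I.3.4 [Israel1979]; E. H. Lieb, M. Loss, Duke Math. J. 71 (1993) 337, §8 [LiebLoss1993]; S. Boyd, L. Vandenberghe (2004) §5.9 [BoydVandenberghe2004].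
-/

noncomputable section

namespace Summit.Ventures.CertifiedManyBodySolver.Theorems

open Real Set NonemptyInterval Filter Topology
open Summit.Ventures.CertifiedManyBodySolver.Observables
open Summit.Ventures.CertifiedManyBodySolver.Downfold
open Summit.Ventures.CertifiedManyBodySolver.Certificates
open Summit.Ventures.CertifiedManyBodySolver
open Literature.MathematicalPhysics.QuantumLattice Literature.MathematicalPhysics.QuantumLattice.ThermodynamicLimit
open Literature.Probability.LatticeModels
open Matrix HubbardWave0
open scoped BigOperators ComplexOrder

/-! ## §0 Chord tools on the P10 slot interval `[−49/100, −47/100]` -/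

/-- The `σ`-chord weights on `[−49/100, −47/100]`: nonnegative, summing to `1`. [folklore] -/
theorem covHg1201P10_patch_slotWeights {σ : ℝ} (hσ : σ ∈ Icc (-49 / 100 : ℝ) (-47 / 100)) :
    0 ≤ (-47 / 100 - σ) / (-47 / 100 - -49 / 100) ∧ 0 ≤ (σ - -49 / 100) / (-47 / 100 - -49 / 100) ∧
      (-47 / 100 - σ) / (-47 / 100 - -49 / 100) + (σ - -49 / 100) / (-47 / 100 - -49 / 100) = 1 := by
  refine ⟨div_nonneg (by linarith [hσ.2]) (by norm_num), div_nonneg (by linarith [hσ.1]) (by norm_num), ?_⟩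
  rw [← add_div]
  have h : (-47 / 100 - σ) + (σ - -49 / 100) = (-47 / 100 - -49 / 100 : ℝ) := by ring
  rw [h]
  exact div_self (by norm_num)

/-- **The target-slot word at `(s, U_A, n)` from ONE corner-objective value and the kinematic inner read.** For a density `0 ≤ n ≤ 22/25`, a slot
`σ ∈ [−49/100, −47/100]`, a torus limit `ω` of unit sector ground states of `hubbardTorusTT' L 1 s U_A'` at density `n`, and an orbit-lower value `v ≤` the
orbit mean of `−X₀(−49/100, U_A)` with `−v ≤ 0.4767609`: the orbit mean of `−X₀(σ, U_A)` is `≥ −0.4767609` (σ-chord of the corner read and the state-free inner-END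
read `−X₀(−47/100, U_A) ≥ −0.4763357`). [cite: KomaTasaki1994, §1] [cite: LiebLoss1993, §8, Theorem 8.2] [cite: HazraVermaRanderia2019, eq. (4)] -/
theorem covHg1201P10_slotWord_of_cornerValue (σ UA s UA' : ℝ) (hσ : σ ∈ Icc (-49 / 100 : ℝ) (-47 / 100))
    {n : ℝ} (hn0 : 0 ≤ n) (hn : n ≤ 22 / 25) {v : ℝ} (hv : -v ≤ (4767609 / 10000000 : ℝ))
    (ω : InfVolFermionState 2) (Ls : ℕ → ℕ) (ψ : ∀ L, Fock (Orb (FermionTorus 2 L)))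
    (hLs : Tendsto Ls atTop atTop)
    (hψ : ∀ j, IsGroundStateInSector (hubbardTorusTT' (Ls j) 1 s UA') (rectN n (Ls j)) 0 (ψ (Ls j)))
    (h1 : ∀ j, star (ψ (Ls j)) ⬝ᵥ ψ (Ls j) = 1) (hω : ω.IsTorusLimitOf ψ Ls)
    (hP : v ≤ ((Finset.univ : Finset (DihedralGroup 4)).card : ℝ)⁻¹ * ∑ g ∈ (Finset.univ : Finset (DihedralGroup 4)),
      (ω.expect (d4ShiftSet g 0 (box 2 7)) (fermionEmbed (PolySite.d4Emb g 0 (box 2 7)) (-oddMomentObsTT (-49 / 100) UA 0))).re) :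
    -(4767609 / 10000000 : ℝ) ≤ ((Finset.univ : Finset (DihedralGroup 4)).card : ℝ)⁻¹ * ∑ g ∈ (Finset.univ : Finset (DihedralGroup 4)),
      (ω.expect (d4ShiftSet g 0 (box 2 7)) (fermionEmbed (PolySite.d4Emb g 0 (box 2 7)) (-oddMomentObsTT σ UA 0))).re := by
  have hn2 : n < 2 := by linarith
  have hKQc : -(-((30977 / 57344 : ℝ) * n / 2 + ((6 / 7 : ℝ) * 0.2581118058 + 1 / 7 * 0.1218750438))) ≤ (4767609 / 10000000 : ℝ) := by
    rw [neg_neg]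
    exact hg1201P10_kinematicReading_le_bar hn
  have hchord := orbitLower_slot_chord_of_two_endObjectives hω.isTranslationInvariant UA (by norm_num : (-49 / 100 : ℝ) < -47 / 100) hσ hP
    (orbitMean_neg_oddMomentTT_lam_zero_ge_kinematic_of_gs (-47 / 100) UA s UA' halfBathtub_m47o100_P10chordLevel_le hn0 hn2 ω Ls ψ hLs hψ h1 hω)
  obtain ⟨ha, hb, hab⟩ := covHg1201P10_patch_slotWeights hσ
  have hprice := neg_convexComb_le_of_neg_le ha hb hab hv hKQc
  linarith

/-! ## §1 Segment bundles FROM CORNER-OBJECTIVE READS (`−X₀(−49/100, ·)` only) -/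

/-- **Left-edge bundle on `[U₁, U₂] × [n₁, n₂] ⊆ ℝ × [0, 22/25]` from corner-objective reads**: per `n`, `U′` an orbit-lower value `vL n U′` for `−X₀(−49/100, U′)` on
the class at `(−49/100, U′, n)` with `−vL n U′ ≤ 0.4767609` ⇒ the `PatchLeftEdgeP10` body at every slot `σ ∈ [−49/100, −47/100]` on that segment (the body of
`LeftEdgeLowUP10` at `(3, 5, 21/25, 22/25)`, of `LeftEdgeHighUP10` at `(5, 17/2, 21/25, 22/25)`). [cite: KomaTasaki1994, §1] [cite: ScalapinoWhiteZhang1993, §II] -/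
theorem covHg1201M19P10_leftEdgeSegment_of_cornerObjective {U₁ U₂ n₁ n₂ : ℝ} (hn₁ : 0 ≤ n₁) (hn₂ : n₂ ≤ 22 / 25) (vL : ℝ → ℝ → ℝ)
    (hL : ∀ n ∈ Set.Icc n₁ n₂, ∀ U' ∈ Set.Icc U₁ U₂,
      ∀ (ω : InfVolFermionState 2) (Ls : ℕ → ℕ) (ψ : ∀ L, Fock (Orb (FermionTorus 2 L))),
      Tendsto Ls atTop atTop →
      (∀ j, IsGroundStateInSector (hubbardTorusTT' (Ls j) 1 (-49 / 100) U') (rectN n (Ls j)) 0 (ψ (Ls j))) →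
      (∀ j, star (ψ (Ls j)) ⬝ᵥ ψ (Ls j) = 1) → ω.IsTorusLimitOf ψ Ls →
      vL n U' ≤ ((Finset.univ : Finset (DihedralGroup 4)).card : ℝ)⁻¹ * ∑ g ∈ (Finset.univ : Finset (DihedralGroup 4)),
        (ω.expect (d4ShiftSet g 0 (box 2 7)) (fermionEmbed (PolySite.d4Emb g 0 (box 2 7)) (-oddMomentObsTT (-49 / 100) U' 0))).re)
    (hcL : ∀ n ∈ Set.Icc n₁ n₂, ∀ U' ∈ Set.Icc U₁ U₂, -vL n U' ≤ (4767609 / 10000000 : ℝ)) :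
    ∀ n ∈ Set.Icc n₁ n₂, ∀ σ ∈ Set.Icc (-49 / 100 : ℝ) (-47 / 100), ∀ U' ∈ Set.Icc U₁ U₂,
      ∀ (ω : InfVolFermionState 2) (Ls : ℕ → ℕ) (ψ : ∀ L, Fock (Orb (FermionTorus 2 L))),
      Tendsto Ls atTop atTop →
      (∀ j, IsGroundStateInSector (hubbardTorusTT' (Ls j) 1 (-49 / 100) U') (rectN n (Ls j)) 0 (ψ (Ls j))) →
      (∀ j, star (ψ (Ls j)) ⬝ᵥ ψ (Ls j) = 1) → ω.IsTorusLimitOf ψ Ls →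
      -(4767609 / 10000000 : ℝ) ≤ ((Finset.univ : Finset (DihedralGroup 4)).card : ℝ)⁻¹ * ∑ g ∈ (Finset.univ : Finset (DihedralGroup 4)),
        (ω.expect (d4ShiftSet g 0 (box 2 7)) (fermionEmbed (PolySite.d4Emb g 0 (box 2 7)) (-oddMomentObsTT σ U' 0))).re :=
  fun n hn σ hσ U' hU' ω Ls ψ hLs hψ h1 hω =>
    covHg1201P10_slotWord_of_cornerValue σ U' (-49 / 100) U' hσ (hn₁.trans hn.1) (hn.2.trans hn₂) (hcL n hn U' hU')
      ω Ls ψ hLs hψ h1 hω (hL n hn U' hU' ω Ls ψ hLs hψ h1 hω)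

/-- **Bottom bundle at `U = 3` on a density segment `[n₁, n₂] ⊆ [0, 22/25]` from corner-objective reads**: per `n` and source `s ∈ [−49/100, −47/100]` an orbit-lower
value `vB n s` for `−X₀(−49/100, 3)` on the class at `(s, 3, n)` with `−vB n s ≤ 0.4767609` ⇒ the `PatchBottomP10` body at every `σ`, `s ∈ [−49/100, σ]` on the segment
(the body of `BottomNHighP10` at `(43/50, 22/25)`). [cite: KomaTasaki1994, §1] [cite: ScalapinoWhiteZhang1993, §II] -/
theorem covHg1201M19P10_bottomSegment_of_cornerObjective {n₁ n₂ : ℝ} (hn₁ : 0 ≤ n₁) (hn₂ : n₂ ≤ 22 / 25) (vB : ℝ → ℝ → ℝ)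
    (hB : ∀ n ∈ Set.Icc n₁ n₂, ∀ s ∈ Set.Icc (-49 / 100 : ℝ) (-47 / 100),
      ∀ (ω : InfVolFermionState 2) (Ls : ℕ → ℕ) (ψ : ∀ L, Fock (Orb (FermionTorus 2 L))),
      Tendsto Ls atTop atTop →
      (∀ j, IsGroundStateInSector (hubbardTorusTT' (Ls j) 1 s 3) (rectN n (Ls j)) 0 (ψ (Ls j))) →
      (∀ j, star (ψ (Ls j)) ⬝ᵥ ψ (Ls j) = 1) → ω.IsTorusLimitOf ψ Ls →
      vB n s ≤ ((Finset.univ : Finset (DihedralGroup 4)).card : ℝ)⁻¹ * ∑ g ∈ (Finset.univ : Finset (DihedralGroup 4)),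
        (ω.expect (d4ShiftSet g 0 (box 2 7)) (fermionEmbed (PolySite.d4Emb g 0 (box 2 7)) (-oddMomentObsTT (-49 / 100) 3 0))).re)
    (hcB : ∀ n ∈ Set.Icc n₁ n₂, ∀ s ∈ Set.Icc (-49 / 100 : ℝ) (-47 / 100), -vB n s ≤ (4767609 / 10000000 : ℝ)) :
    ∀ n ∈ Set.Icc n₁ n₂, ∀ σ ∈ Set.Icc (-49 / 100 : ℝ) (-47 / 100), ∀ s ∈ Set.Icc (-49 / 100 : ℝ) σ,
      ∀ (ω : InfVolFermionState 2) (Ls : ℕ → ℕ) (ψ : ∀ L, Fock (Orb (FermionTorus 2 L))),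
      Tendsto Ls atTop atTop →
      (∀ j, IsGroundStateInSector (hubbardTorusTT' (Ls j) 1 s 3) (rectN n (Ls j)) 0 (ψ (Ls j))) →
      (∀ j, star (ψ (Ls j)) ⬝ᵥ ψ (Ls j) = 1) → ω.IsTorusLimitOf ψ Ls →
      -(4767609 / 10000000 : ℝ) ≤ ((Finset.univ : Finset (DihedralGroup 4)).card : ℝ)⁻¹ * ∑ g ∈ (Finset.univ : Finset (DihedralGroup 4)),
        (ω.expect (d4ShiftSet g 0 (box 2 7)) (fermionEmbed (PolySite.d4Emb g 0 (box 2 7)) (-oddMomentObsTT σ 3 0))).re :=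
  fun n hn σ hσ s hs ω Ls ψ hLs hψ h1 hω =>
    covHg1201P10_slotWord_of_cornerValue σ 3 s 3 hσ (hn₁.trans hn.1) (hn.2.trans hn₂) (hcB n hn s ⟨hs.1, hs.2.trans hσ.2⟩)
      ω Ls ψ hLs hψ h1 hω (hB n hn s ⟨hs.1, hs.2.trans hσ.2⟩ ω Ls ψ hLs hψ h1 hω)

/-! ## §2 The same from ONE `boxdual/0` tree cell (cap-only `…OrbitLowerBoxRow`, or WINDOWED `…OrbitLowerBoxRowW` with the kinematic floor discharged) -/

/-- Coordinates of a point of a literal `Fin 3` cell (router order `(U, t′, n)`); local copy of `Downfold.mem_s2Box_vec3` to keep this module's import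
cone route-independent. [folklore] -/
private theorem mem_s2Box_vec3A {a b c a' b' c' : ℝ} {θ : Fin 3 → ℝ}
    (hθ : θ ∈ Set.Icc (![a, b, c] : Fin 3 → ℝ) ![a', b', c']) :
    (a ≤ θ 0 ∧ θ 0 ≤ a') ∧ (b ≤ θ 1 ∧ θ 1 ≤ b') ∧ (c ≤ θ 2 ∧ θ 2 ≤ c') := by
  rw [Set.mem_Icc, Pi.le_def, Pi.le_def] at hθ
  obtain ⟨hlo, hhi⟩ := hθ
  have h0 := hlo 0; have h1 := hlo 1; have h2 := hlo 2
  have h0' := hhi 0; have h1' := hhi 1; have h2' := hhi 2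
  simp only [Matrix.cons_val_zero, Matrix.cons_val_one, Matrix.head_cons, Matrix.cons_val_two,
    Matrix.tail_cons] at h0 h1 h2 h0' h1' h2'
  exact ⟨⟨h0, h0'⟩, ⟨h1, h1'⟩, ⟨h2, h2'⟩⟩

/-- Reading a cap-only box row of the P10 corner objective `−X₀(−49/100; Uo)` at the literal point `![U, t′, n]` of its cell, cap discharged, with the
`U`-label moved to `U_A` (at `λ = 0` the word carries no `U`, `oddMomentObsTT_lam_zero`): the orbit-lower statement on the torus-limit ground-state class at
`(t′, U, n)`. (P10-specialised form of box-1's `covHg1201_boxRow_orbitLower_at` + `covHg1201_neg_oddMomentObsTT_lam_zero_label`.) [cite: BoydVandenberghe2004, §5.9] -/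
theorem covHg1201P10_boxRow_orbitLower_at {lo hi : Fin 3 → ℝ} {cap : (Fin 3 → ℝ) → ℝ} {r : ℚ} {Uo : ℝ}
    (h : SquareTTPrimeCorrOrbitLowerBoxRow lo hi cap r Finset.univ (box 2 7) (-oddMomentObsTT (-49 / 100) Uo 0))
    (hcap : ∀ θ ∈ Set.Icc lo hi, energyDensityTT' 1 (θ 1) (θ 0) (θ 2) ≤ cap θ)
    {U tp n : ℝ} (hθ : (![U, tp, n] : Fin 3 → ℝ) ∈ Set.Icc lo hi) (UA : ℝ) :
    ∀ (ω : InfVolFermionState 2) (Ls : ℕ → ℕ) (ψ : ∀ L, Fock (Orb (FermionTorus 2 L))),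
      Tendsto Ls atTop atTop →
      (∀ j, IsGroundStateInSector (hubbardTorusTT' (Ls j) 1 tp U) (rectN n (Ls j)) 0 (ψ (Ls j))) →
      (∀ j, star (ψ (Ls j)) ⬝ᵥ ψ (Ls j) = 1) → ω.IsTorusLimitOf ψ Ls →
      ((r : ℚ) : ℝ) ≤ ((Finset.univ : Finset (DihedralGroup 4)).card : ℝ)⁻¹ * ∑ g ∈ (Finset.univ : Finset (DihedralGroup 4)),
        (ω.expect (d4ShiftSet g 0 (box 2 7)) (fermionEmbed (PolySite.d4Emb g 0 (box 2 7)) (-oddMomentObsTT (-49 / 100) UA 0))).re := by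
  intro ω Ls ψ hLs hψ h1 hω
  rw [oddMomentObsTT_lam_zero (-49 / 100) UA, ← oddMomentObsTT_lam_zero (-49 / 100) Uo]
  exact h.uncond hcap _ hθ ω Ls ψ hLs hψ h1 hω

/-- Membership of a literal P10 triple in a literal `Fin 3` cell (router order `(U, t′, n)`). [folklore] -/
theorem covHg1201P10_vec3_mem_Icc {a b c a' b' c' x y z : ℝ} (h : (a ≤ x ∧ x ≤ a') ∧ (b ≤ y ∧ y ≤ b') ∧ (c ≤ z ∧ z ≤ c')) :
    (![x, y, z] : Fin 3 → ℝ) ∈ Set.Icc (![a, b, c] : Fin 3 → ℝ) ![a', b', c'] := by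
  obtain ⟨⟨hx, hx'⟩, ⟨hy, hy'⟩, ⟨hz, hz'⟩⟩ := h
  refine ⟨fun i => ?_, fun i => ?_⟩ <;> fin_cases i <;> simp [hx, hx', hy, hy', hz, hz']

/-- **P10 CELL FLOOR** (node-free): on any cell `![U₁, s₁, n₁] … ![U₂, s₂, n₂]` with `0 ≤ U₁`, `−27/50 ≤ s₁`, `s₂ ≤ 27/50`, `0 ≤ n₁`, `n₂ < 2`, the a-priori kinematic
floor `−124827703/50000000 ≤ e₀(1, θ 1, θ 0, θ 2)` (`hg1201_M19b_apriori_kinFloor`; the P10 legs carry this literal, `hg1201_P10_apriori_kinFloor_tpm49o100`).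
[cite: LiebLoss1993, §8, Theorem 8.2] -/
theorem covHg1201P10_cell_kinFloor {U₁ U₂ s₁ s₂ n₁ n₂ : ℝ} (hU₁ : 0 ≤ U₁) (hs₁ : -27 / 50 ≤ s₁) (hs₂ : s₂ ≤ 27 / 50) (hn₁ : 0 ≤ n₁) (hn₂ : n₂ < 2) :
    ∀ θ ∈ Set.Icc (![U₁, s₁, n₁] : Fin 3 → ℝ) ![U₂, s₂, n₂],
      (fun _ : Fin 3 → ℝ => (((-124827703/50000000 : ℚ)) : ℝ)) θ ≤ energyDensityTT' 1 (θ 1) (θ 0) (θ 2) := by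
  intro θ hθ
  obtain ⟨⟨h0, -⟩, ⟨h1, h1'⟩, ⟨h2, h2'⟩⟩ := mem_s2Box_vec3A hθ
  have hs : |θ 1| ≤ 27 / 50 := by
    rw [abs_le]; constructor <;> linarith
  exact hg1201_M19b_apriori_kinFloor hs (hU₁.trans h0) (hn₁.trans h2) (lt_of_le_of_lt h2' hn₂)

/-- **Left-edge bundle on `[U₁, U₂] × [n₁, n₂]` FROM ONE U-SEGMENT BOX ROW** (router order `(U, t′, n)`, cell degenerate in `t′ = −49/100`): the tree cell
`SquareTTPrimeCorrOrbitLowerBoxRow ![U₁, −49/100, n₁] ![U₂, −49/100, n₂] cap r univ Λ₇ (−X₀(−49/100; Uo))` (any `U`-label `Uo`: `λ = 0`), cap discharged, `−r ≤ 0.4767609`.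
[cite: BoydVandenberghe2004, §5.9] [cite: KomaTasaki1994, §1] -/
theorem covHg1201M19P10_leftEdgeSegment_of_boxRow {U₁ U₂ n₁ n₂ : ℝ} (hn₁ : 0 ≤ n₁) (hn₂ : n₂ ≤ 22 / 25)
    {cap : (Fin 3 → ℝ) → ℝ} {r : ℚ} (Uo : ℝ)
    (hrow : SquareTTPrimeCorrOrbitLowerBoxRow ![U₁, -49 / 100, n₁] ![U₂, -49 / 100, n₂] cap r Finset.univ (box 2 7)
      (-oddMomentObsTT (-49 / 100) Uo 0))
    (hcap : ∀ θ ∈ Set.Icc (![U₁, -49 / 100, n₁] : Fin 3 → ℝ) ![U₂, -49 / 100, n₂], energyDensityTT' 1 (θ 1) (θ 0) (θ 2) ≤ cap θ)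
    (hr : -((r : ℚ) : ℝ) ≤ (4767609 / 10000000 : ℝ)) :
    ∀ n ∈ Set.Icc n₁ n₂, ∀ σ ∈ Set.Icc (-49 / 100 : ℝ) (-47 / 100), ∀ U' ∈ Set.Icc U₁ U₂,
      ∀ (ω : InfVolFermionState 2) (Ls : ℕ → ℕ) (ψ : ∀ L, Fock (Orb (FermionTorus 2 L))),
      Tendsto Ls atTop atTop →
      (∀ j, IsGroundStateInSector (hubbardTorusTT' (Ls j) 1 (-49 / 100) U') (rectN n (Ls j)) 0 (ψ (Ls j))) →
      (∀ j, star (ψ (Ls j)) ⬝ᵥ ψ (Ls j) = 1) → ω.IsTorusLimitOf ψ Ls →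
      -(4767609 / 10000000 : ℝ) ≤ ((Finset.univ : Finset (DihedralGroup 4)).card : ℝ)⁻¹ * ∑ g ∈ (Finset.univ : Finset (DihedralGroup 4)),
        (ω.expect (d4ShiftSet g 0 (box 2 7)) (fermionEmbed (PolySite.d4Emb g 0 (box 2 7)) (-oddMomentObsTT σ U' 0))).re := by
  refine covHg1201M19P10_leftEdgeSegment_of_cornerObjective hn₁ hn₂ (fun _ _ => ((r : ℚ) : ℝ))
    (fun n hn U' hU' ω Ls ψ hLs hψ h1 hω => ?_) (fun n hn U' hU' => hr)
  exact covHg1201P10_boxRow_orbitLower_at hrow hcap (covHg1201P10_vec3_mem_Icc ⟨hU', ⟨le_rfl, le_rfl⟩, hn⟩) U' ω Ls ψ hLs hψ h1 hω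

/-- **Bottom bundle on `n ∈ [n₁, n₂]` FROM ONE t′-SEGMENT BOX ROW at `U = 3`**: the tree cell `SquareTTPrimeCorrOrbitLowerBoxRow ![3, −49/100, n₁] ![3, −47/100, n₂] cap r
univ Λ₇ (−X₀(−49/100; Uo))`, cap discharged, `−r ≤ 0.4767609`. [cite: BoydVandenberghe2004, §5.9] [cite: KomaTasaki1994, §1] -/
theorem covHg1201M19P10_bottomSegment_of_boxRow {n₁ n₂ : ℝ} (hn₁ : 0 ≤ n₁) (hn₂ : n₂ ≤ 22 / 25)
    {cap : (Fin 3 → ℝ) → ℝ} {r : ℚ} (Uo : ℝ)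
    (hrow : SquareTTPrimeCorrOrbitLowerBoxRow ![3, -49 / 100, n₁] ![3, -47 / 100, n₂] cap r Finset.univ (box 2 7)
      (-oddMomentObsTT (-49 / 100) Uo 0))
    (hcap : ∀ θ ∈ Set.Icc (![3, -49 / 100, n₁] : Fin 3 → ℝ) ![3, -47 / 100, n₂], energyDensityTT' 1 (θ 1) (θ 0) (θ 2) ≤ cap θ)
    (hr : -((r : ℚ) : ℝ) ≤ (4767609 / 10000000 : ℝ)) :
    ∀ n ∈ Set.Icc n₁ n₂, ∀ σ ∈ Set.Icc (-49 / 100 : ℝ) (-47 / 100), ∀ s ∈ Set.Icc (-49 / 100 : ℝ) σ,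
      ∀ (ω : InfVolFermionState 2) (Ls : ℕ → ℕ) (ψ : ∀ L, Fock (Orb (FermionTorus 2 L))),
      Tendsto Ls atTop atTop →
      (∀ j, IsGroundStateInSector (hubbardTorusTT' (Ls j) 1 s 3) (rectN n (Ls j)) 0 (ψ (Ls j))) →
      (∀ j, star (ψ (Ls j)) ⬝ᵥ ψ (Ls j) = 1) → ω.IsTorusLimitOf ψ Ls →
      -(4767609 / 10000000 : ℝ) ≤ ((Finset.univ : Finset (DihedralGroup 4)).card : ℝ)⁻¹ * ∑ g ∈ (Finset.univ : Finset (DihedralGroup 4)),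
        (ω.expect (d4ShiftSet g 0 (box 2 7)) (fermionEmbed (PolySite.d4Emb g 0 (box 2 7)) (-oddMomentObsTT σ 3 0))).re := by
  refine covHg1201M19P10_bottomSegment_of_cornerObjective hn₁ hn₂ (fun _ _ => ((r : ℚ) : ℝ))
    (fun n hn s hs ω Ls ψ hLs hψ h1 hω => ?_) (fun n hn s hs => hr)
  exact covHg1201P10_boxRow_orbitLower_at hrow hcap (covHg1201P10_vec3_mem_Icc ⟨⟨le_rfl, le_rfl⟩, hs, hn⟩) 3 ω Ls ψ hLs hψ h1 hω

/-- **Left-edge bundle FROM ONE WINDOWED cell** `![U₁, −49/100, n₁] … ![U₂, −49/100, n₂]` (`0 ≤ U₁`, `0 ≤ n₁`, `n₂ ≤ 22/25`) with the a-priori kinematic floor row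
(discharged here), cap row `cap` discharged by `hcap`, `−r ≤ 0.4767609`. [cite: ScalapinoWhiteZhang1993, §II] [cite: WangEtAl2024, §III] -/
theorem covHg1201M19P10_leftEdgeSegment_of_boxRowW_kinFloor {U₁ U₂ n₁ n₂ : ℝ} (hU₁ : 0 ≤ U₁) (hn₁ : 0 ≤ n₁) (hn₂ : n₂ ≤ 22 / 25)
    {cap : (Fin 3 → ℝ) → ℝ} {r : ℚ} (Uo : ℝ)
    (hrow : SquareTTPrimeCorrOrbitLowerBoxRowW ![U₁, -49 / 100, n₁] ![U₂, -49 / 100, n₂]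
      (fun _ : Fin 3 → ℝ => (((-124827703/50000000 : ℚ)) : ℝ)) cap r Finset.univ (box 2 7) (-oddMomentObsTT (-49 / 100) Uo 0))
    (hcap : ∀ θ ∈ Set.Icc (![U₁, -49 / 100, n₁] : Fin 3 → ℝ) ![U₂, -49 / 100, n₂], energyDensityTT' 1 (θ 1) (θ 0) (θ 2) ≤ cap θ)
    (hr : -((r : ℚ) : ℝ) ≤ (4767609 / 10000000 : ℝ)) :
    ∀ n ∈ Set.Icc n₁ n₂, ∀ σ ∈ Set.Icc (-49 / 100 : ℝ) (-47 / 100), ∀ U' ∈ Set.Icc U₁ U₂,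
      ∀ (ω : InfVolFermionState 2) (Ls : ℕ → ℕ) (ψ : ∀ L, Fock (Orb (FermionTorus 2 L))),
      Tendsto Ls atTop atTop →
      (∀ j, IsGroundStateInSector (hubbardTorusTT' (Ls j) 1 (-49 / 100) U') (rectN n (Ls j)) 0 (ψ (Ls j))) →
      (∀ j, star (ψ (Ls j)) ⬝ᵥ ψ (Ls j) = 1) → ω.IsTorusLimitOf ψ Ls →
      -(4767609 / 10000000 : ℝ) ≤ ((Finset.univ : Finset (DihedralGroup 4)).card : ℝ)⁻¹ * ∑ g ∈ (Finset.univ : Finset (DihedralGroup 4)),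
        (ω.expect (d4ShiftSet g 0 (box 2 7)) (fermionEmbed (PolySite.d4Emb g 0 (box 2 7)) (-oddMomentObsTT σ U' 0))).re :=
  covHg1201M19P10_leftEdgeSegment_of_boxRow hn₁ hn₂ Uo
    (fun θ hθ ω Ls ψ hLs hψ hψ1 hω hc => hrow θ hθ ω Ls ψ hLs hψ hψ1 hω
      (covHg1201P10_cell_kinFloor hU₁ (by norm_num) (by norm_num) hn₁ (by linarith) θ hθ) hc) hcap hr

/-- **Bottom bundle FROM ONE WINDOWED cell** `![3, −49/100, n₁] … ![3, −47/100, n₂]` (`0 ≤ n₁`, `n₂ ≤ 22/25`), kinematic floor row discharged here, cap row by `hcap`,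
`−r ≤ 0.4767609`. [cite: ScalapinoWhiteZhang1993, §II] [cite: WangEtAl2024, §III] -/
theorem covHg1201M19P10_bottomSegment_of_boxRowW_kinFloor {n₁ n₂ : ℝ} (hn₁ : 0 ≤ n₁) (hn₂ : n₂ ≤ 22 / 25)
    {cap : (Fin 3 → ℝ) → ℝ} {r : ℚ} (Uo : ℝ)
    (hrow : SquareTTPrimeCorrOrbitLowerBoxRowW ![3, -49 / 100, n₁] ![3, -47 / 100, n₂]
      (fun _ : Fin 3 → ℝ => (((-124827703/50000000 : ℚ)) : ℝ)) cap r Finset.univ (box 2 7) (-oddMomentObsTT (-49 / 100) Uo 0))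
    (hcap : ∀ θ ∈ Set.Icc (![3, -49 / 100, n₁] : Fin 3 → ℝ) ![3, -47 / 100, n₂], energyDensityTT' 1 (θ 1) (θ 0) (θ 2) ≤ cap θ)
    (hr : -((r : ℚ) : ℝ) ≤ (4767609 / 10000000 : ℝ)) :
    ∀ n ∈ Set.Icc n₁ n₂, ∀ σ ∈ Set.Icc (-49 / 100 : ℝ) (-47 / 100), ∀ s ∈ Set.Icc (-49 / 100 : ℝ) σ,
      ∀ (ω : InfVolFermionState 2) (Ls : ℕ → ℕ) (ψ : ∀ L, Fock (Orb (FermionTorus 2 L))),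
      Tendsto Ls atTop atTop →
      (∀ j, IsGroundStateInSector (hubbardTorusTT' (Ls j) 1 s 3) (rectN n (Ls j)) 0 (ψ (Ls j))) →
      (∀ j, star (ψ (Ls j)) ⬝ᵥ ψ (Ls j) = 1) → ω.IsTorusLimitOf ψ Ls →
      -(4767609 / 10000000 : ℝ) ≤ ((Finset.univ : Finset (DihedralGroup 4)).card : ℝ)⁻¹ * ∑ g ∈ (Finset.univ : Finset (DihedralGroup 4)),
        (ω.expect (d4ShiftSet g 0 (box 2 7)) (fermionEmbed (PolySite.d4Emb g 0 (box 2 7)) (-oddMomentObsTT σ 3 0))).re :=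
  covHg1201M19P10_bottomSegment_of_boxRow hn₁ hn₂ Uo
    (fun θ hθ ω Ls ψ hLs hψ hψ1 hω hc => hrow θ hθ ω Ls ψ hLs hψ hψ1 hω
      (covHg1201P10_cell_kinFloor (by norm_num) (by norm_num) (by norm_num) hn₁ (by linarith) θ hθ) hc) hcap hr

/-! ## §3 Kernel Hartree–Fock density-CHORD caps DISCHARGED on the P10 strip cells `n ∈ [43/50, 22/25]` (valid for every `U ≥ 0`) -/

/-- **LEFT-EDGE P10 STRIP-CELL CAP**: on `![U₁, −49/100, 43/50] … ![U₂, −49/100, 22/25]` with `0 ≤ U₁`, `e₀(1, θ 1, θ 0, θ 2)` lies below the density chord of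
box-1's kernel HF point rows at `43/50` (`−15571047/10⁷ + U·1849/10⁴`) and `22/25` (`−15830689/10⁷ + U·121/625`), each affine in `U`.
[cite: BachLiebSolovej1994, eq. (2c.36)] [cite: Israel1979, Thm. I.3.4] -/
theorem covHg1201P10_leftEdgeStripCell_hfChordCap {U₁ U₂ : ℝ} (hU₁ : 0 ≤ U₁) :
    ∀ θ ∈ Set.Icc (![U₁, -49 / 100, 43 / 50] : Fin 3 → ℝ) ![U₂, -49 / 100, 22 / 25],
      energyDensityTT' 1 (θ 1) (θ 0) (θ 2) ≤
        (fun θ : Fin 3 → ℝ => ((22 / 25 - θ 2) * ((((-15571047/10000000 : ℚ)) : ℝ) + θ 0 * (((1849/10000 : ℚ)) : ℝ)) +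
          (θ 2 - 43 / 50) * ((((-15830689/10000000 : ℚ)) : ℝ) + θ 0 * (((121/625 : ℚ)) : ℝ))) / (22 / 25 - 43 / 50)) θ := by
  intro θ hθ
  beta_reduce
  obtain ⟨⟨h0, -⟩, ⟨h1, h1'⟩, ⟨h2, h2'⟩⟩ := mem_s2Box_vec3A hθ
  have e1 : θ 1 = -49 / 100 := le_antisymm h1' h1
  have hU : 0 ≤ θ 0 := hU₁.trans h0
  have c86 := hfCap_hg1201P10_m490_n086_point hU
  have c88 := hfCap_hg1201P10_m490_n088_point hU
  rw [e1]
  rcases h2.eq_or_lt with h | hlt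
  · rw [← h]
    calc energyDensityTT' 1 (-49 / 100) (θ 0) (43 / 50)
        ≤ (((-15571047/10000000 : ℚ)) : ℝ) + θ 0 * (((1849/10000 : ℚ)) : ℝ) := c86
      _ = _ := by field_simp; ring
  rcases h2'.eq_or_lt with h' | hlt'
  · rw [h']
    calc energyDensityTT' 1 (-49 / 100) (θ 0) (22 / 25)
        ≤ (((-15830689/10000000 : ℚ)) : ℝ) + θ 0 * (((121/625 : ℚ)) : ℝ) := c88
      _ = _ := by field_simp; ring
  exact energyDensityTT'_le_density_chord 1 (-49 / 100) hU (n₁ := 43 / 50) (n := θ 2) (n₂ := 22 / 25) (by norm_num) hlt hlt' (by norm_num) c86 c88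

/-- **BOTTOM P10 STRIP-CELL CAP** (2-D in `(s, n)`): on `![UA, −49/100, 43/50] … ![UA, −47/100, 22/25]` with `0 ≤ UA`, the density chord of box-1's `s`-affine kernel HF
strip rows `hfCap_hg1201P10_m490_m470_n086` (at `43/50`) and `…_n088` (at `22/25`), both valid on `s ∈ [−49/100, −47/100]`.
[cite: BachLiebSolovej1994, eq. (2c.36)] [cite: Israel1979, Thm. I.3.4] -/
theorem covHg1201P10_bottomStripCell_hfChordCap {UA : ℝ} (hUA : 0 ≤ UA) :
    ∀ θ ∈ Set.Icc (![UA, -49 / 100, 43 / 50] : Fin 3 → ℝ) ![UA, -47 / 100, 22 / 25],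
      energyDensityTT' 1 (θ 1) (θ 0) (θ 2) ≤
        (fun θ : Fin 3 → ℝ => ((22 / 25 - θ 2) * ((((-3714349523/2500000000 : ℚ)) : ℝ) + θ 1 * (((7272339/50000000 : ℚ)) : ℝ) + θ 0 * ((43/50 : ℝ) / 2) ^ 2) +
          (θ 2 - 43 / 50) * ((((-1866385337/1250000000 : ℚ)) : ℝ) + θ 1 * (((4589831/25000000 : ℚ)) : ℝ) + θ 0 * ((22/25 : ℝ) / 2) ^ 2)) / (22 / 25 - 43 / 50)) θ := by
  intro θ hθ
  beta_reduce
  obtain ⟨⟨h0, -⟩, ⟨h1, h1'⟩, ⟨h2, h2'⟩⟩ := mem_s2Box_vec3A hθ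
  have hU : 0 ≤ θ 0 := hUA.trans h0
  have c86 := hfCap_hg1201P10_m490_m470_n086 hU h1 h1'
  have c88 := hfCap_hg1201P10_m490_m470_n088 hU h1 h1'
  rcases h2.eq_or_lt with h | hlt
  · rw [← h]
    calc energyDensityTT' 1 (θ 1) (θ 0) (43 / 50)
        ≤ (((-3714349523/2500000000 : ℚ)) : ℝ) + θ 1 * (((7272339/50000000 : ℚ)) : ℝ) + θ 0 * ((43/50 : ℝ) / 2) ^ 2 := c86
      _ = _ := by field_simp; ring
  rcases h2'.eq_or_lt with h' | hlt'
  · rw [h']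
    calc energyDensityTT' 1 (θ 1) (θ 0) (22 / 25)
        ≤ (((-1866385337/1250000000 : ℚ)) : ℝ) + θ 1 * (((4589831/25000000 : ℚ)) : ℝ) + θ 0 * ((22/25 : ℝ) / 2) ^ 2 := c88
      _ = _ := by field_simp; ring
  exact energyDensityTT'_le_density_chord 1 (θ 1) hU (n₁ := 43 / 50) (n := θ 2) (n₂ := 22 / 25) (by norm_num) hlt hlt' (by norm_num) c86 c88

end Summit.Ventures.CertifiedManyBodySolver.Theorems

end
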